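import Literature.MathematicalPhysics.QuantumFieldTheory.Balaban1983to89.B2Eq266Restrictions255
import Literature.MathematicalPhysics.QuantumFieldTheory.Balaban1983to89.B2Eq265From255

/-!
# `Balaban1983to89.B2Eq266From255` — [Balaban1982Higgs2] **Lemma 2.4 (2.66), THE DERIVATIVE CLAUSE, UNDER THE RESTRICTIONS (2.55) IN
# FULL** p. 572 ON THE (Higgs)₂,₃ CARRIER OF RECORD: own `B2Eq266Restrictions255.eq266_higgs_region_restr255` with `A^{(k)} :=` the cut-off
# minimizer (2.54), its regularity `δ_A` FED BY LEMMA 2.3 (2.60) under (2.55)₁,₂ (p23's F12a, r14's Lemma 2.3 pointwise), the box geometry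
# read off one integer margin (p23's F11), which ALSO serves as D5's integer depth `m₀` — p23's F10/F11/F12 located edits for the value
# clause applied to the derivative clause in one step, by name

statement-level skeleton of published theorems with citation tags; proofs where landed; nothing here is a claim
about the Yang–Mills mass gap

PDF held: `paper:balaban1982-cmp86-higgs23-ii` (journal page = PDF page + 554), p. 570 [PDF 16] ((2.55)), p. 571 [PDF 17] (Lemma 2.3
(2.59)–(2.60)), p. 572 [PDF 18] (Lemma 2.4, «From the property (2.60) …») — renders/text layer of record.

CITATION HEADER (lean-in-tree rule).  T. Bałaban, *(Higgs)₂,₃ quantum fields in a finite volume. II. An upper bound*,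
Commun. Math. Phys. **86** (1982) 555–594, doi:10.1007/bf01214890 [Balaban1982Higgs2]; part I [Balaban1982Higgs1] AS TYPED.  Cell
`lit-balaban` (HOME `run/shared/lean/pub/lit-balaban/`), reader/typer seat **r14** gen 21 (B2 second reader; unit `lit-balaban-r14-g21`;
free-target protocol G.5-34(d): the derivative lane of row B2.Lem2.4; TAKING line HOME/STATUS.md for this stem); SKELETON row
**B2.Lem2.4** (fold owner r02, second reader r14; decl of record `B2.Lemma24Printed`, head `proved p250408 · …` UNCHANGED — cells-only
member, an OPTIONAL TWIN of p23's F10–F12 for the derivative clause, zero head weight by the owner's ruling 2026-08-23T09:30Z).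
USED BY NAME, never restated: own `B2Eq266Restrictions255.eq266_higgs_region_restr255`; p23's F12a `B2Lemma23From255.lemma23_restr255`
(Lemma 2.3 under (2.55)₁,₂, over r14's `B2Lemma23HiggsLattice`), F10 `B2Eq265From260.grad_ofSite_cutMin_le`, F11 `B2Eq265BoxMargins.
{box_subset_of_margin, two_mul_side_le_of_margin, mem_underRegion_of_tdist_le}`, the typer's `B2Eq255Concrete.Restr255`, r14's
`B2Lemma23HiggsLattice.cutMin`, `B3MultiscaleFields.{toSite, ofSite}`, `B1Eq211ZeroFieldTorus.Shape`.

WHAT IS PRINTED (p. 570–572).  (2.55) p.570 (the four inequalities, render of record); Lemma 2.3 p.571: *«Under the restrictions (2.55), we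
have … (∂^η_μA^{(k)})(x) = O(p(Lᵏε)), x ∈ Bᵏ(Λ₂^{(k−1)′}). (2.60)»*; Lemma 2.4 p.572: *«Under the restrictions (2.55) we have … (D^η_{A^{(k)}}
φ^{(k)})(b) = O(p(Lᵏε)) for b ⊂ Bᵏ(Λ₇^{(k−1)′}). (2.66) … From the property (2.60) we have the inequality |A^{(k)}(x) − A^{(k)}(y)| ≦ O(p(Lᵏε)
r(Lᵏε)).»*

WHAT THIS FILE PROVES (kernel-checked, zero `sorry`; one theorem — NO definition, NO `Prop`-valued fact; axioms standard).
 **`eq266_higgs_region_from255`** = p23's F12 `B2Eq265From255.eq265_higgs_region_from255` hypothesis list word for word plus D5's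
 `(μ : Fin P.d)`, with constants `C₁ C₂ C₃ D₂ D₃ D₄ D₅` and the conclusion of own `eq266_higgs_region_restr255` in which the integer depth
 `m₀` IS F11's margin `m` (`{|z − x| ≤ Lᵏm} ⊂ □` by `mem_underRegion_of_tdist_le`; `m ≥ 1` from `2r_S + 2LᵏK₀(d+1) + 1 ≤ Lᵏm`) and
 `A := ofSite (cutMin C₀ μ₀² a_V k ζ (toSite A′))` — the derivative clause «under the restrictions (2.55)», all four conjuncts used
 ((2.55)₁,₂ feed Lemma 2.3's `δ_A`, (2.55)₃,₄ feed `λ`, `t′`).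

HONEST SCOPE / DIFFERENCES FROM PRINT (recorded, not hidden).  (a) As F12's and D5's: STILL HYPOTHESES are the box data (`□₂ = q + [0,S)ᵈ`
a cell-product box in a proper window, `□₁` the centred cube of radius `R₁ ≤ m`, the margin `m` with `Lᵏm ≥` the depth radius), the
regions `□₂ ⊆ Λ₂′`, `□₁ ⊆ Λ₆′ ⊆ Λ₂′`, `Bᵏ(Λ₂′)` a big-block union, Lemma 2.3's cube of radius `R_n` about `Λ₂′` inside `Λ₋₁` (the (2.8) room,
G-B2-12 reading), the two smallness conditions on `δ_A` (printed scalings), and the layer factor `(Π_ν|S_ν|)K₀^{d−1}m^{−d}` (bounded for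
print's `□`; a reading).  (b) The F13–F16 conversions (tails as `O((Lᵏε)^κ)`, printed thresholds, tower regions) are not applied (optional
twins on the letters).  (c) Value: the derivative clause (2.66) is now in the same state on the carrier as the value clause (2.65) at p23's
F12 — «UNDER THE RESTRICTIONS (2.55) IN FULL», remainder explicit; NOT summit progress; optional twin, zero head weight.
-/

open scoped BigOperators

noncomputable section

namespace Literature.MathematicalPhysics.QuantumFieldTheory.Balaban1983to89.B2Eq266From255

open HiggsLattice (ChargeData covDeriv)
open HiggsAveraging (blockIter toFinest)
open B2Eq255Concrete (bgScalar256 underRegion mem_underRegion Restr255)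
open B2Eq266Restrictions255 (eq266_higgs_region_restr255)
open B2Eq265From260 (grad_ofSite_cutMin_le)
open B2Eq265BoxMargins (box_subset_of_margin two_mul_side_le_of_margin mem_underRegion_of_tdist_le)
open B2Lemma23From255 (lemma23_restr255)
open B2Lemma23HiggsLattice (cutMin)
open B1Eq211ZeroFieldTorus (Shape)
open B3MultiscaleFields (toSite ofSite)
open B1Ineq225RegularBox (cellBox)
open B1Ineq234Concrete (distC tdist_self)
open B1TorusRegionHSizes (IsBigBlockUnion)
open B1TorusCubeCover (half)
open B1TorusCubeLocality26 (rS)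

variable {P : HiggsLattice.Params} {N : ℕ}

/-! ## (2.66) under the restrictions (2.55), all four conjuncts by name -/

section Eq266From255

/-- **LEMMA 2.4 (2.66), DERIVATIVE CLAUSE, ON THE (Higgs)₂,₃ CARRIER — «Under the restrictions (2.55)», all four conjuncts; the bond
`⟨x, x + εe_μ⟩` with `x_k` the centre of `□₁` and at least `m` inside `□₂`.**  TYPED vs PRINTED: p23's F12 `eq265_higgs_region_from255`
hypothesis list word for word, `+ (μ : Fin P.d)` after `x`; the conclusion is own `eq266_higgs_region_restr255`'s with `m₀ := m` and
`A := ofSite (cutMin C₀ μ₀² a_V k ζ (toSite A′))`. [cite: Balaban1982Higgs2, Lemma 2.4 (2.66) p.572]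
[cite: Balaban1982Higgs2, (2.55) p.570, Lemma 2.3 (2.60) p.571]
[cite: Balaban1982Higgs2, Lemma 2.4 proof p.572 «From the property (2.60) we have the inequality |A^{(k)}(x) − A^{(k)}(y)| ≦ O(p(Lᵏε)r(Lᵏε)).»] -/
theorem eq266_higgs_region_from255 (d L : ℕ) (hd : 1 ≤ d) (hL : Odd L ∧ 1 < L) {a : ℝ} (ha : 0 < a) {msq : ℝ} (hmsq : 0 < msq)
    {aV : ℝ} (haV : 0 < aV) {mu0sq : ℝ} (hmu0 : 0 < mu0sq)
    (N : ℕ) (C : ChargeData N) (ε₀ : ℝ) (creg β : ℝ) (hcreg : 0 ≤ creg) (hβ : 0 < β) :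
    ∃ δ CV CF : ℝ, 0 < δ ∧ 0 < CV ∧ 0 < CF ∧
    ∃ K₀min : ℕ, ∀ K₀ : ℕ, K₀min ≤ K₀ → ∃ e₁ t : ℝ, 0 < e₁ ∧ 0 < t ∧
      ∃ C₁ C₂ C₃ D₂ D₃ D₄ D₅ : ℝ, 0 ≤ C₁ ∧ 0 ≤ C₂ ∧ 0 ≤ C₃ ∧ 0 ≤ D₂ ∧ 0 ≤ D₃ ∧ 0 ≤ D₄ ∧ 0 ≤ D₅ ∧
      ∀ (P : HiggsLattice.Params) (_ : Shape P), P.d = d → P.L = L → K₀ ∣ P.M →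
      ∀ {k : ℕ}, 1 ≤ k → k ≤ P.K → (∀ μ, 3 * half P k K₀ ≤ P.sitesPerDir 0 μ) → P.mesh k ≤ ε₀ → P.mesh k ≤ 1 →
      ∀ (Λ₂ Λ₆ sq₂ sq₁ : Finset (HiggsLattice.Site P k)) (S : Fin P.d → Finset ℕ) (q : HiggsLattice.Site P k) (Sbox : ℕ),
        Λ₆ ⊆ Λ₂ → sq₂ ⊆ Λ₂ → sq₁ ⊆ Λ₆ →
        IsBigBlockUnion k K₀ (underRegion k Λ₂) → underRegion k sq₂ = cellBox k K₀ S →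
        (∀ μ : Fin P.d, P.L ^ k * Sbox < P.sitesPerDir 0 μ) →
      -- `□₂` IS the box `q + [0,S)ᵈ` of coarse sites, `□ = B^k(□₂)` smaller than half the torus
        (∀ y : HiggsLattice.Site P k, y ∈ sq₂ ↔ ∀ ν : Fin P.d, (y ν - q ν).val < Sbox) →
        (∀ μ : Fin P.d, 2 * (P.L ^ k * Sbox) ≤ P.sitesPerDir 0 μ) →
      -- `□₁` is the box of coarse sites of radius `R₁` (corner `q₁`); `m ≥ R₁` a coarse margin with `Lᵏm ≥` the depth radius
      ∀ (q₁ : HiggsLattice.Site P k) (R₁ m : ℕ), R₁ ≤ m → 2 * rS P k K₀ + 2 * half P k K₀ * (P.d + 1) + 1 ≤ P.L ^ k * m →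
        (∀ y : HiggsLattice.Site P k, y ∈ sq₁ ↔ ∀ ν : Fin P.d, (y ν - q₁ ν).val < 2 * R₁ + 1) →
      -- the region `Λ₋₁` of (2.55); the cutoff `ζ^{(k)}` of (2.44); the cube of radius `R_n ≥ ρ + 1` about every `y ∈ Λ₂` inside `Λ₋₁` ((2.8))
      ∀ (Λm1 : Finset (HiggsLattice.Site P k))
        (ζ : HiggsLattice.Site P 0 → HiggsLattice.Site P k → ℝ) (ρ ρ₁ : ℝ), 0 ≤ ρ₁ →
        (∀ x y', |ζ x y'| ≤ 1) →
        (∀ x y', ζ x y' ≠ 0 → (HiggsLattice.Site.tdist (blockIter k x) y' : ℝ) ≤ ρ) →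
        (∀ x y', (HiggsLattice.Site.tdist (blockIter k x) y' : ℝ) ≤ ρ₁ → ζ x y' = 1) →
        (∀ (x : HiggsLattice.Site P 0) (ν : Fin P.d) (y' : HiggsLattice.Site P k), |ζ (x.shift ν) y' - ζ x y'| ≤ ((P.L : ℝ) ^ k)⁻¹) →
      ∀ (Rn : ℕ), ρ + 1 ≤ (Rn : ℝ) → (∀ μ : Fin P.d, 2 * (2 * Rn + 1) ≤ P.sitesPerDir k μ) →
        (∀ y ∈ Λ₂, ∀ y' : HiggsLattice.Site P k, HiggsLattice.Site.tdist y y' ≤ Rn → y' ∈ Λm1) →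
      -- a charge datum on `ℝ^d`, the step's vector field `A′`, and the letters of (2.55)
      ∀ (C₀ : ChargeData P.d) (A' : HiggsLattice.VecField P k) {c₁ pℓ tA tPhi : ℝ}, 0 ≤ c₁ → 0 ≤ pℓ → 0 ≤ tPhi →
      -- `δA` is at least the (2.60) bound read off (2.55)₁,₂, and small in the two printed scalings
      ∀ {δA : ℝ}, ((P.L : ℝ) ^ k)⁻¹ * (CV * P.d * (P.mesh k * (c₁ * pℓ)) + CF * Real.exp (-(δ * ρ₁)) * (c₁ * tA * pℓ)) ≤ δA →
          (P.L : ℝ) ^ k * δA * |C.e| ≤ t →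
        ∀ {ec : ℝ}, 0 < ec → ec ≤ e₁ → (P.L : ℝ) ^ k * P.mesh k * |C.e| * δA ≤ creg * ec ^ β →
      -- `x ∈ Bᵏ(ȳ)` with `ȳ` the centre of `□₁` and at least `m` inside `□₂` in every direction
      ∀ (x : HiggsLattice.Site P 0) (μ : Fin P.d),
        (∀ ν : Fin P.d, m ≤ ((blockIter k x) ν - q ν).val ∧ ((blockIter k x) ν - q ν).val + m < Sbox) →
        (∀ ν : Fin P.d, ((blockIter k x) ν - q₁ ν).val = R₁) →
      -- THE RESTRICTIONS (2.55) on `Λ₋₁` for the fields `A′, φ` of the step and the background `A^{(k)} = a_kζ^{(k)}G_kQ_k^*A′` — all four conjuncts used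
      ∀ (φ : HiggsLattice.ScalarField P k N),
        Restr255 C c₁ pℓ tA tPhi k Λm1 A' φ (ofSite (cutMin C₀ mu0sq aV k ζ (toSite A'))) →
        ‖covDeriv C (ofSite (cutMin C₀ mu0sq aV k ζ (toSite A'))) (bgScalar256 C msq a k Λ₂ Λ₆ (ofSite (cutMin C₀ mu0sq aV k ζ (toSite A'))) φ)
            (⟨x, μ⟩ : HiggsLattice.PBond P 0)‖
          ≤ B1.aSeq a P.L k * (P.mesh k)⁻¹ * (c₁ * tPhi * pℓ) *
                (C₁ * Real.exp (-(1 / (4 * K₀) * (distC (underRegion k sq₂) x / (P.L : ℝ) ^ k)))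
                  + C₂ * Real.exp (-(1 / (4 * K₀) * ((R₁ : ℝ) + 1))))
            + (|C.e| * (δA * (P.d * ((P.L : ℝ) ^ k * Sbox))) * (B1.aSeq a P.L k * D₃ * (c₁ * tPhi * pℓ))
              + D₂ * P.mesh k *
                (B1.aSeq a P.L k * (P.mesh k)⁻¹ ^ 2 * (|C.e| * (δA * (P.d * ((P.L : ℝ) ^ k * Sbox))) * P.mesh 0 * (P.d * ((P.L : ℝ) ^ k - 1))) * (c₁ * tPhi * pℓ)
                  + |C.e| * (δA * (P.d * ((P.L : ℝ) ^ k * Sbox))) * (P.d * (2 * (B1.aSeq a P.L k * (P.mesh k)⁻¹ ^ 2 * (c₁ * tPhi * pℓ) * D₄ * P.mesh k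
                        + |C.e| * (δA * (P.d * ((P.L : ℝ) ^ k * Sbox))) * (B1.aSeq a P.L k * D₃ * (c₁ * tPhi * pℓ))) + |C.e| * (δA * (P.d * ((P.L : ℝ) ^ k * Sbox))) * (B1.aSeq a P.L k * D₃ * (c₁ * tPhi * pℓ))))
                  + (P.mesh 0)⁻¹ * (|C.e| * δA) * (P.d * (B1.aSeq a P.L k * D₃ * (c₁ * tPhi * pℓ)))
                  + B1.aSeq a P.L k * (P.mesh k)⁻¹ ^ 2 *
                      ((2 * (|C.e| * (δA * (P.d * ((P.L : ℝ) ^ k * Sbox))) * P.mesh 0 * (P.d * ((P.L : ℝ) ^ k - 1)))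
                        + (|C.e| * (δA * (P.d * ((P.L : ℝ) ^ k * Sbox))) * P.mesh 0 * (P.d * ((P.L : ℝ) ^ k - 1))) ^ 2) * (B1.aSeq a P.L k * D₃ * (c₁ * tPhi * pℓ))))
              + (P.mesh 0)⁻¹ * (|C.e| * (δA * (P.d * ((P.L : ℝ) ^ k * Sbox)))) * (P.d * (B1.aSeq a P.L k * D₃ * (c₁ * tPhi * pℓ))) *
                  (D₅ * (∏ ν : Fin P.d, ((S ν).card : ℝ)) * (K₀ : ℝ) ^ (d - 1) * ((m : ℝ) ^ d)⁻¹ * P.mesh 0))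
            + B1.aSeq a P.L k * C₃ * (P.mesh k)⁻¹ * (4 * K₀ * ((P.mesh k * (c₁ * pℓ) + P.mesh k * |C.e| * (δA * (P.d * ((P.L : ℝ) ^ k * Sbox))) * (c₁ * tPhi * pℓ)) * P.d) + Real.exp (-(1 / (4 * K₀) * ((R₁ : ℝ) + 1))) * (c₁ * tPhi * pℓ)) := by
  -- Lemma 2.3's constants under (2.55)₁,₂ (p23's `B2Lemma23From255`), then own (2.66)-under-(2.55)₃,₄
  obtain ⟨δ, CV, CF, hδ, hCV, hCF, h23⟩ := lemma23_restr255 d L hd hL haV hmu0 ε₀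
  have hL2 : 2 ≤ L := by omega
  obtain ⟨K₀min, h⟩ := eq266_higgs_region_restr255 d L hd hL2 ha hmsq N C ε₀ creg β hcreg hβ
  refine ⟨δ, CV, CF, hδ, hCV, hCF, K₀min, fun K₀ hK₀ => ?_⟩
  obtain ⟨e₁, t, he₁, ht, C₁, C₂, C₃, D₂, D₃, D₄, D₅, hC₁, hC₂, hC₃, hD₂, hD₃, hD₄, hD₅, h⟩ := h K₀ hK₀
  refine ⟨e₁, t, he₁, ht, C₁, C₂, C₃, D₂, D₃, D₄, D₅, hC₁, hC₂, hC₃, hD₂, hD₃, hD₄, hD₅, ?_⟩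
  intro P S hPd hPL hK₀M k hk1 hkK h3 hε h1 Λ₂ Λ₆ sq₂ sq₁ Sfin q Sbox h62 hs2 h16 hΩΛ hbox hSbox hsq₂ h2S q₁ R₁ m hR₁m hRm hsq₁
    Λm1 ζ ρ ρ₁ hρ₁ zeta_abs zeta_supp zeta_one zeta_lip Rn hRn hRn2 hcube C₀ A' c₁ pℓ tA tPhi hc₁ hpℓ htPhi δA h60δ ht' ec hec hle hsmall
    x μ hmargin hcentre φ h255
  -- F11's geometry, by name; the margin `m` is also the integer depth of the layer term
  have h12 : sq₁ ⊆ sq₂ := box_subset_of_margin hkK q Sbox sq₂ sq₁ hsq₂ hSbox q₁ (blockIter k x) R₁ m hR₁m hsq₁ hcentre hmargin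
  have hS₁ : ∀ μ : Fin P.d, 2 * (2 * R₁ + 1) ≤ P.sitesPerDir k μ :=
    two_mul_side_le_of_margin hkK h2S q (blockIter k x) R₁ m hR₁m hmargin
  have hx : ∀ z, HiggsLattice.Site.tdist x z ≤ 2 * rS P k K₀ + 2 * half P k K₀ * (P.d + 1) + 1 → z ∈ underRegion k sq₂ :=
    fun z hz => mem_underRegion_of_tdist_le hkK q Sbox sq₂ hsq₂ h2S x m _ hRm hmargin hz
  have hxm : ∀ z, HiggsLattice.Site.tdist x z ≤ P.L ^ k * m → z ∈ underRegion k sq₂ :=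
    fun z hz => mem_underRegion_of_tdist_le hkK q Sbox sq₂ hsq₂ h2S x m _ le_rfl hmargin hz
  have hm1 : 1 ≤ m := by
    by_contra h0
    have : m = 0 := by omega
    rw [this, mul_zero] at hRm
    omega
  -- `Λ₂ ⊆ Λ₋₁` from the cube condition
  have h2m1 : Λ₂ ⊆ Λm1 := fun y hy => hcube y hy y (by rw [tdist_self]; exact Nat.zero_le _)
  -- (2.60) under (2.55)₁,₂ for the cut-off minimizer, point by point, BY NAME
  have hgrad : ∀ z ∈ underRegion k Λ₂, ∀ μ ν : Fin P.d,
      |ofSite (cutMin C₀ mu0sq aV k ζ (toSite A')) ⟨z.shift ν, μ⟩ - ofSite (cutMin C₀ mu0sq aV k ζ (toSite A')) ⟨z, μ⟩| ≤ δA := by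
    subst hPd
    refine grad_ofSite_cutMin_le C₀ mu0sq aV k ζ (toSite A') Λ₂ h60δ ?_
    intro z hz ν
    exact (h23 P S rfl hPL C₀ hk1 hkK hε ζ ρ ρ₁ hρ₁ zeta_abs zeta_supp zeta_one zeta_lip Λm1 Λ₂ Rn hRn hRn2 hcube C A' φ _ hc₁ hpℓ
      h255 z hz).2 ν
  have hδA : 0 ≤ δA := by
    refine le_trans ?_ h60δ
    have h1' : 0 ≤ CV * P.d * (P.mesh k * (c₁ * pℓ)) := by
      have := (P.mesh_pos k).le
      positivity
    have h2' : 0 ≤ CF * Real.exp (-(δ * ρ₁)) * (c₁ * tA * pℓ) := by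
      -- `c₁·t_A·pℓ ≥ ‖A′(x_k)‖ ≥ 0` (conjunct 2 at the point `x_k ∈ Λ₂ ⊆ Λ₋₁`)
      have hxΛ : blockIter k x ∈ Λ₂ := hs2 ((mem_underRegion k sq₂ x).mp (hx x (by rw [tdist_self]; exact Nat.zero_le _)))
      have ht0 : 0 ≤ c₁ * tA * pℓ := (norm_nonneg _).trans (h255.2.1 _ (h2m1 hxΛ))
      positivity
    exact mul_nonneg (inv_nonneg.mpr (pow_nonneg (Nat.cast_nonneg _) k)) (add_nonneg h1' h2')
  exact h P hPd hPL hK₀M hk1 hkK h3 hε h1 Λ₂ Λ₆ sq₂ sq₁ Sfin q Sbox h62 hs2 h12 h16 hΩΛ hbox hSbox hsq₂ h2S q₁ R₁ hS₁ hsq₁ _ hδA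
    hgrad ht' hec hle hsmall x μ hx m hm1 hxm hcentre φ Λm1 A' hc₁ hpℓ htPhi (h62.trans h2m1) h255

end Eq266From255

end Literature.MathematicalPhysics.QuantumFieldTheory.Balaban1983to89.B2Eq266From255

end
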